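import Literature.Probability.RandomPlanarGeometry.SAWCountZdSymbolSecondCancellation
import Literature.Probability.RandomPlanarGeometry.SAWCountZdSymbolSecondLowerCount
import Literature.Probability.RandomPlanarGeometry.SAWCountZdSymbolSecondTopCount
import HarnessLib

/-!
# SECOND CANCELLATION, UNCONDITIONAL: `[X^{2j−4}] B_j = 0` and `deg S_j ≤ max(j, 2j − 5)` for every `j ≥ 4`

Topic `Literature/Probability/RandomPlanarGeometry` (the «SYMBOL POLYNOMIALITY» programme, second layer — the assembly: `SAWCountZdSymbolSecondCancellation.lean`
(a-p1 g26: the conditional core `coeff_symbolCorrPoly_two_mul_sub_four_eq_zero` under `SecondLayerSums i`, `3 ≤ i ≤ j`), `SAWCountZdSymbolSecondLowerCount.lean`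
(a-p1 g26: `three_mul_secondShapeSumBelow`, the `V'`-half), `SAWCountZdSymbolSecondTopCount.lean` (a-p1 g26: `secondShapeSumTop_eq`, the `U'`-half)).

PRINTED CONTEXT (locators only; nothing is quoted digit-for-digit). Madras–Slade (1993) §1.1 eq. (1.1.8) p. 5, Definition 1.2.4, §1.2 p. 10; Clisby–Liang–Slade (2007)
§3.3 eqs. (29)/(31). NOT IN PRINT as far as the lane's desks could locate: the statements below.

THE THEOREM. With `[X^{n−j}] P_n = 2^n S_j(n)` (`n ≥ 2j − 1`, `P_n(d) = c_n(ℤ^d)`), `S_j = A_j − B_j`, `A_j = (−1)^j/(2^j j!)·(X−1)⋯(X−j)`, `B_j = Σ_{i=2}^{j} R_i(X)E_{j−i}(X−i)`: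
★ `secondLayerSums_of_le : ∀ i ≥ 3, SecondLayerSums i` (both second-layer census closed forms are theorems for every `i`), hence for every `j ≥ 4`:
★★★ `coeff_symbolCorrPoly_two_mul_sub_four_eq_zero'` — **`[X^{2j−4}] B_j = 0`**; ★★★ `natDegree_symbolCorrPoly_le_sub_five'` — **`deg B_j ≤ 2j − 5`**; ★★★
`natDegree_coeffPoly_le_sub_five` — **`deg S_j ≤ max(j, 2j − 5)`**; ★★ `natDegree_coeffPoly_of_le_four` — for `j ≤ 4` the coefficient polynomial has degree EXACTLY `j`
with leading coefficient `(−1)^j/(2^j j!)` (the monic face of the tree's `P₄` law, now structurally); ★★★ `exists_polynomial_countPoly_coeff_natDegree_le'` — the `j`-th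
`1/d`-symbol of `c_n(ℤ^d)` is `2^n` times a polynomial in `n` of degree `≤ max(j, 2j − 5)`. The second of the `j − 3` cancellations predicted by the STRUCTURE CONJECTURE
«`deg P_j = j`» (FINDING-ZD-FOURTH-SYMBOL §8) is thus a theorem for all `j`; the register cells BQ-1…BQ-3 («Am. BQ») are instances of the two census theorems.

THIS FILE (lane «pcv-sawmu», a-p1 g26; all PROVED, standard axioms): ★ `secondLayerSums_of_le`, ★★★ `coeff_symbolCorrPoly_two_mul_sub_four_eq_zero'`,
★★★ `natDegree_symbolCorrPoly_le_sub_five'`, ★★★ `natDegree_coeffPoly_le_sub_five`, ★★ `natDegree_coeffPoly_of_le_four`, ★★★ `exists_polynomial_countPoly_coeff_natDegree_le'`.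
[cite: MadrasSlade1993, §1.1 eq. (1.1.8) p. 5; Definition 1.2.4; §1.2 (p. 10)] [cite: ClisbyLiangSlade2007, §3.3 eqs. (29)/(31)]

Provenance: lane «pcv-sawmu», a-p1 g26 (2026-08-28).
-/

noncomputable section

open Finset
open scoped BigOperators
open Literature.Probability.LatticeModels
open Literature.Probability.RandomPlanarGeometry.SAW
open Literature.Probability.Percolation

namespace Literature.Probability.RandomPlanarGeometry.SAW.Zd

namespace WordTypes

/-- ★ BOTH SECOND-LAYER CENSUS CLOSED FORMS HOLD FOR EVERY `i ≥ 3`: `U'_i = (2i−4)(4i−7)(2i−5)‼2^{2i−3}` and `3V'_i = (2i−4)(i+3)(2i−5)‼2^{2i−3}`.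
[cite: MadrasSlade1993, §1.1 eq. (1.1.8) p. 5; Definition 1.2.4; lane theorem] -/
theorem secondLayerSums_of_le (i : ℕ) (hi : 3 ≤ i) : SecondLayerSums i :=
  ⟨secondShapeSumTop_eq i hi, three_mul_secondShapeSumBelow i hi⟩

/-- ★★★ SECOND CANCELLATION (unconditional): for every `j ≥ 4`, the `X^{2j−4}`-coefficient of the bad-word correction `B_j = Σ_{i=2}^{j} R_i(X) E_{j−i}(X−i)` to the
`j`-th `1/d`-symbol of `c_n(ℤ^d)` VANISHES. [cite: MadrasSlade1993, §1.1 eq. (1.1.8) p. 5; Definition 1.2.4] [cite: ClisbyLiangSlade2007, §3.3 eqs. (29)/(31); lane theorem] -/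
theorem coeff_symbolCorrPoly_two_mul_sub_four_eq_zero' (j : ℕ) (hj : 4 ≤ j) : (symbolCorrPoly j).coeff (2 * j - 4) = 0 :=
  coeff_symbolCorrPoly_two_mul_sub_four_eq_zero j hj (fun i hi _ => secondLayerSums_of_le i hi)

/-- ★★★ Hence `deg B_j ≤ 2j − 5` for every `j ≥ 4`. [cite: MadrasSlade1993, §1.1 eq. (1.1.8) p. 5; Definition 1.2.4]
[cite: ClisbyLiangSlade2007, §3.3 eqs. (29)/(31); lane theorem] -/
theorem natDegree_symbolCorrPoly_le_sub_five' (j : ℕ) (hj : 4 ≤ j) : (symbolCorrPoly j).natDegree ≤ 2 * j - 5 :=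
  natDegree_symbolCorrPoly_le_sub_five j hj (fun i hi _ => secondLayerSums_of_le i hi)

/-- ★★★ And `deg S_j ≤ max(j, 2j − 5)` for every `j ≥ 4` (sharp for `j ≤ 5`). [cite: MadrasSlade1993, §1.1 eq. (1.1.8) p. 5; Definition 1.2.4]
[cite: ClisbyLiangSlade2007, §3.3 eqs. (29)/(31); lane theorem] -/
theorem natDegree_coeffPoly_le_sub_five (j : ℕ) (hj : 4 ≤ j) : (coeffPoly j).natDegree ≤ max j (2 * j - 5) :=
  natDegree_coeffPoly_le_of_secondLayer j hj (fun i hi _ => secondLayerSums_of_le i hi)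

/-- ★★ THE MONIC FACE FOR `j ≤ 4`: for `2 ≤ j ≤ 4` the coefficient polynomial `S_j` has degree EXACTLY `j` and leading coefficient `(−1)^j/(2^j·j!)` — the bad-word
correction is subleading (`deg B_j ≤ 2j − 5 < j` for `j = 4`; first cancellation for `j ≤ 3`), so `[d^{n−j}] c_n(ℤ^d) = 2^{n−j}(−1)^j n^j/j! + O(2^n n^{j−1})` for
`j = 2, 3, 4` structurally (the tree's `P₂, P₃, P₄` laws). [cite: MadrasSlade1993, §1.1 eq. (1.1.8) p. 5; Definition 1.2.4] [cite: ClisbyLiangSlade2007, §3.3 eqs. (29)/(31); lane theorem] -/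
theorem natDegree_coeffPoly_of_le_four (j : ℕ) (hj : 2 ≤ j) (hj5 : j ≤ 4) :
    (coeffPoly j).natDegree = j ∧ (coeffPoly j).leadingCoeff = (-1 : ℚ) ^ j / (2 ^ j * (j.factorial : ℚ)) := by
  rcases Nat.lt_or_ge j 4 with h | h
  · exact natDegree_coeffPoly_of_le_three j hj (by omega)
  · have hB : (symbolCorrPoly j).natDegree < j := lt_of_le_of_lt (natDegree_symbolCorrPoly_le_sub_five' j h) (by omega)
    have hB' : (symbolCorrPoly j).degree < (symbolMainPoly j).degree := by
      rw [Polynomial.degree_eq_natDegree (p := symbolMainPoly j) (by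
        intro h0; have := natDegree_symbolMainPoly j; rw [h0, Polynomial.natDegree_zero] at this; omega), natDegree_symbolMainPoly]
      exact lt_of_le_of_lt (Polynomial.degree_le_natDegree) (by exact_mod_cast hB)
    refine ⟨?_, ?_⟩
    · rw [coeffPoly, Polynomial.natDegree_sub_eq_left_of_natDegree_lt (by rw [natDegree_symbolMainPoly]; exact hB), natDegree_symbolMainPoly]
    · rw [coeffPoly, Polynomial.leadingCoeff_sub_of_degree_lt hB', leadingCoeff_symbolMainPoly]

/-- ★★★ COEFFICIENT POLYNOMIALITY WITH TWO CANCELLATIONS: for every `j ≥ 4` there is `S ∈ ℚ[X]` of degree `≤ max(j, 2j − 5)` with `[X^{n−j}] P_n = 2^n S(n)` for all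
`n ≥ 2j − 1`. [cite: MadrasSlade1993, §1.1 eq. (1.1.8) p. 5; §1.2 p. 10] [cite: ClisbyLiangSlade2007, §3.3 eqs. (29)/(31); lane theorem] -/
theorem exists_polynomial_countPoly_coeff_natDegree_le' (j : ℕ) (hj : 4 ≤ j) :
    ∃ S : Polynomial ℚ, S.natDegree ≤ max j (2 * j - 5) ∧ ∀ n : ℕ, 2 * j ≤ n + 1 → (countPoly n).coeff (n - j) = 2 ^ n * S.eval (n : ℚ) :=
  ⟨coeffPoly j, natDegree_coeffPoly_le_sub_five j hj, fun n hn => countPoly_coeff_eq_pow_mul_eval_coeffPoly j (by omega) n hn⟩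

end WordTypes

end Literature.Probability.RandomPlanarGeometry.SAW.Zd
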